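import Mathlib
import HarnessLib
import Summits.NavierStokesRegularity.NavierStokesRegularity.Theorems.AxisTwistDoorAveragedConeLiouvillePositivityStep

/-!
# Route `AxisTwistDoor`, crux `AveragedConeLiouville` (stmt-NavierStokesRegularity-26889), line `lrt_shell` —
# discharging `PositivityPropagationFactC` WITHOUT Nazarov–Ural'tseva, brick P3: FROM A DENSE BALL TO A POSITIVE BALL

The first (and only non-trivial) step of the positivity chain: the comparison lemma of brick P2 (`one_step`) run
with the datum `g = χ · min(1, (V(s,·)/λ)₊)` (`χ` a bump around a small ball `B̄(q, h)`), which is `≤ V(s,·)/λ`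
pointwise and `= 1` on the part `E` of `B̄(q, h)` where `V(s,·) ≥ λ`; its integral is at least `vol E`.

* `continuous_mul_of_tsupport_subset` — `χ f` is continuous when `χ` is continuous with `tsupport χ ⊆ O`, `O` open,
  and `f` is continuous on `O` (used with `f = min(1, (V(s,·)/λ)₊)`, continuous only where `V` is).
* `density_step` — **dense ball ⇒ positive ball**: with the universal constants `c₁ > 0`, `C₂ ≥ 0` of `one_step`:
  if `V` is a non-negative classical supersolution of `∂ₜV − ΔV + ⟪b, ∇V⟫ ≥ 0`, `|b| ≤ Λ`, on
  `[s, s+τ] × B̄(q, R)`, `4h < R`, `4h² ≤ τ ≤ 8h²`, and `V(s, ·) ≥ λ > 0` on a measurable `E ⊆ B̄(q, h)` with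
  `vol E ≥ η ≥ 0`, then `V(s+τ, ·) ≥ λ (c₁ (2h)⁻³ η − C₂ (2h/(R−2h))³ − 16Λh)` on `B̄(q, 4h)`.

Seat ns-atd-p1 (LEAD g2).  WHAT THIS IS NOT: not a statement about Navier–Stokes regularity; linear parabolic
comparison estimates serving a STAGED door route.  Lands `--supports` the crux item as a helper.
-/

noncomputable section

-- the summit and its single sub-problem share the name (CONVENTIONS §1), as in every Theorems file
set_option linter.dupNamespace false

namespace Summit.NavierStokesRegularity.NavierStokesRegularity.Theorems.AveragedConeLiouville.PositivityDensity

open scoped InnerProductSpace ENNReal Laplacian Topology NNReal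
open Set Function MeasureTheory Metric Filter Real
open Literature.Analysis.UnboundedOperators
open Summit.NavierStokesRegularity.NavierStokesRegularity.Theorems.AveragedConeLiouville.PositivityStep

/-! ### A cut-off product is continuous -/

/-- If `χ` is continuous with `tsupport χ ⊆ O`, `O` open, and `f` is continuous on `O`, then `χ · f` is continuous
(everywhere: near a point outside `O` it vanishes identically). -/
theorem continuous_mul_of_tsupport_subset {X : Type*} [TopologicalSpace X] {χ f : X → ℝ} {O : Set X}
    (hχ : Continuous χ) (hsub : tsupport χ ⊆ O) (hO : IsOpen O) (hf : ContinuousOn f O) :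
    Continuous fun y => χ y * f y := by
  refine continuous_iff_continuousAt.2 fun y => ?_
  by_cases hy : y ∈ O
  · exact hχ.continuousAt.mul (hf.continuousAt (hO.mem_nhds hy))
  · have hy' : y ∉ tsupport χ := fun h => hy (hsub h)
    have h0 : (fun z => χ z * f z) =ᶠ[𝓝 y] fun _ => 0 := by
      filter_upwards [notMem_tsupport_iff_eventuallyEq.1 hy'] with z hz
      simp [hz]
    exact (continuousAt_const.congr h0.symm)

/-! ### From a dense ball to a positive ball -/

/-- **Dense ball ⇒ positive ball.**  There are universal constants `c₁ > 0`, `C₂ ≥ 0` such that: if `V` is `C²` on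
an open neighbourhood `W` of `[s, s+τ] × B̄(q, R)`, `V ≥ 0` there, `∂ₜV − ΔV + ⟪b, ∇V⟫ ≥ 0` with `|b| ≤ Λ`
(`Λ ≥ 0`) on `(s, s+τ] × B(q, R)`, `4h < R`, `4h² ≤ τ ≤ 8h²`, and `V(s, ·) ≥ λ > 0` on a measurable set
`E ⊆ B̄(q, h)` of measure `≥ η ≥ 0`, then
`V(s+τ, x) ≥ λ (c₁ (2h)⁻³ η − C₂ (2h/(R − 2h))³ − 16Λh)` for every `x ∈ B̄(q, 4h)`. -/
theorem density_step : ∃ c₁ C₂ : ℝ, 0 < c₁ ∧ 0 ≤ C₂ ∧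
    ∀ (V : ℝ → EuclideanSpace ℝ (Fin 3) → ℝ) (b : ℝ → EuclideanSpace ℝ (Fin 3) → EuclideanSpace ℝ (Fin 3))
      (W : Set (ℝ × EuclideanSpace ℝ (Fin 3))) (q : EuclideanSpace ℝ (Fin 3)) (s τ h R Λ lam η : ℝ)
      (E : Set (EuclideanSpace ℝ (Fin 3))),
      IsOpen W → Icc s (s + τ) ×ˢ closedBall q R ⊆ W → ContDiffOn ℝ 2 (uncurry V) W → 0 ≤ Λ →
      (∀ t ∈ Ioc s (s + τ), ∀ x ∈ ball q R, ‖b t x‖ ≤ Λ) →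
      (∀ t ∈ Icc s (s + τ), ∀ x ∈ closedBall q R, 0 ≤ V t x) →
      (∀ t ∈ Ioc s (s + τ), ∀ x ∈ ball q R,
        0 ≤ deriv (fun σ => V σ x) t - (Δ (V t)) x + ⟪b t x, gradient (V t) x⟫_ℝ) →
      0 < h → 4 * h < R → 4 * h ^ 2 ≤ τ → τ ≤ 8 * h ^ 2 → 0 < lam →
      MeasurableSet E → E ⊆ closedBall q h → (∀ x ∈ E, lam ≤ V s x) → 0 ≤ η → ENNReal.ofReal η ≤ volume E →
      ∀ x ∈ closedBall q (4 * h),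
        lam * (c₁ / (2 * h) ^ 3 * η - C₂ * (2 * h / (R - 2 * h)) ^ 3 - 16 * Λ * h) ≤ V (s + τ) x := by
  obtain ⟨c₁, C₂, hc₁, hC₂, hstep⟩ := one_step
  refine ⟨c₁, C₂, hc₁, hC₂, ?_⟩
  intro V b W q s τ h R Λ lam η E hW hWsub hV hΛ hb hV0 hsup hh hhR hτ1 hτ2 hlam hEm hEsub hEV hη hηE x hx
  have hτ : 0 < τ := lt_of_lt_of_le (by positivity) hτ1
  have hsI : s ∈ Icc s (s + τ) := ⟨le_rfl, by linarith⟩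
  -- the slice `V s` is continuous on the open ball `B(q, R)`
  have hVs : ContinuousOn (V s) (ball q R) := by
    have hmaps : MapsTo (fun y : EuclideanSpace ℝ (Fin 3) => (s, y)) (ball q R) W :=
      fun y hy => hWsub ⟨hsI, ball_subset_closedBall hy⟩
    have h1 : ContinuousOn (fun y : EuclideanSpace ℝ (Fin 3) => (s, y)) (ball q R) := by fun_prop
    exact hV.continuousOn.comp h1 hmaps
  -- the datum `g = χ · f`, `f = max 0 (min 1 (V(s,·)/λ))`
  let χ : ContDiffBump q := ⟨h, 2 * h, hh, by linarith⟩
  set f : EuclideanSpace ℝ (Fin 3) → ℝ := fun y => max 0 (min 1 (V s y / lam)) with hf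
  set g : EuclideanSpace ℝ (Fin 3) → ℝ := fun y => χ y * f y with hg
  have hf0 : ∀ y, 0 ≤ f y := fun y => le_max_left _ _
  have hf1 : ∀ y, f y ≤ 1 := fun y => max_le zero_le_one (min_le_left _ _)
  have hfc : ContinuousOn f (ball q R) := by
    have hoc : Continuous (fun v : ℝ => max 0 (min 1 v)) := continuous_const.max (continuous_const.min continuous_id)
    exact hoc.comp_continuousOn (hVs.div_const lam)
  have hχsub : tsupport (χ : EuclideanSpace ℝ (Fin 3) → ℝ) ⊆ ball q R := by
    rw [χ.tsupport_eq]
    exact closedBall_subset_ball (by show 2 * h < R; linarith)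
  have hgc : Continuous g := continuous_mul_of_tsupport_subset χ.continuous hχsub isOpen_ball hfc
  have hg0 : ∀ y, 0 ≤ g y := fun y => mul_nonneg χ.nonneg (hf0 y)
  have hg1 : ∀ y, g y ≤ 1 := fun y =>
    (mul_le_mul χ.le_one (hf1 y) (hf0 y) zero_le_one).trans (by norm_num)
  have hgsupp : ∀ y, g y ≠ 0 → y ∈ closedBall q (2 * h) := by
    intro y hy
    have hχy : χ y ≠ 0 := fun h0 => hy (by simp [hg, h0])
    have : y ∈ support (χ : EuclideanSpace ℝ (Fin 3) → ℝ) := hχy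
    rw [χ.support_eq] at this
    exact ball_subset_closedBall this
  have hgcs : HasCompactSupport g := by
    refine HasCompactSupport.of_support_subset_isCompact (isCompact_closedBall q (2 * h)) ?_
    intro y hy
    exact hgsupp y hy
  -- `λ g ≤ V(s, ·)` on the big ball
  have hinit : ∀ y ∈ closedBall q R, lam * g y ≤ V s y := by
    intro y hy
    have hV0y : 0 ≤ V s y := hV0 s hsI y hy
    have hfy : lam * f y ≤ V s y := by
      by_cases hle : V s y / lam ≤ 1
      · have : f y = max 0 (V s y / lam) := by simp only [hf, min_eq_right hle]
        rw [this, max_eq_right (div_nonneg hV0y hlam.le), mul_div_cancel₀ _ hlam.ne']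
      · push Not at hle
        have : f y = 1 := by simp only [hf, min_eq_left hle.le, max_eq_right zero_le_one]
        rw [this, mul_one]
        have := (lt_div_iff₀ hlam).1 hle
        linarith
    have hgf : g y ≤ f y := mul_le_of_le_one_left (hf0 y) χ.le_one
    nlinarith [mul_le_mul_of_nonneg_left hgf hlam.le]
  -- the one-step lemma with support radius `2h`
  have h2h : 0 < 2 * h := by positivity
  have hmain := hstep V b W q s τ (2 * h) R Λ lam g hW hWsub hV hΛ hb hV0 hsup h2h (by linarith)
    (by nlinarith) (by nlinarith) hgc hgcs hg0 hg1 hgsupp hlam.le hinit x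
    (by simpa [show 2 * (2 * h) = 4 * h by ring] using hx)
  -- `∫ g ≥ vol E ≥ η`: on `E` the bump is `1` and `V(s,·) ≥ λ`, so `g = 1`
  have hEfin : volume E ≠ ⊤ :=
    ne_top_of_le_ne_top (by
      rw [EuclideanSpace.volume_closedBall_fin_three]
      exact ENNReal.mul_ne_top (ENNReal.pow_ne_top ENNReal.ofReal_ne_top) ENNReal.ofReal_ne_top)
      (measure_mono hEsub)
  have hint : η ≤ ∫ z, g z := by
    have h1 : ∫ z in E, (1 : ℝ) ≤ ∫ z in E, g z := by
      refine setIntegral_mono_on (integrableOn_const hEfin) (hgc.integrable_of_hasCompactSupport hgcs).integrableOn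
        hEm fun z hz => ?_
      have hχz : χ z = 1 := χ.one_of_mem_closedBall (hEsub hz)
      have hfz : f z = 1 := by
        have : 1 ≤ V s z / lam := by rw [le_div_iff₀ hlam, one_mul]; exact hEV z hz
        simp only [hf, min_eq_left this, max_eq_right zero_le_one]
      simp [hg, hχz, hfz]
    have h2 : ∫ z in E, g z ≤ ∫ z, g z :=
      setIntegral_le_integral (hgc.integrable_of_hasCompactSupport hgcs) (Eventually.of_forall hg0)
    have h3 : ∫ z in E, (1 : ℝ) = (volume E).toReal := by
      rw [setIntegral_const, smul_eq_mul, mul_one, Measure.real]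
    have h4 : η ≤ (volume E).toReal := by
      have := ENNReal.toReal_mono hEfin hηE
      rwa [ENNReal.toReal_ofReal hη] at this
    linarith
  -- bookkeeping
  have hcost : 8 * Λ * (2 * h) = 16 * Λ * h := by ring
  rw [hcost] at hmain
  refine le_trans (mul_le_mul_of_nonneg_left ?_ hlam.le) hmain
  have : c₁ / (2 * h) ^ 3 * η ≤ c₁ / (2 * h) ^ 3 * ∫ z, g z :=
    mul_le_mul_of_nonneg_left hint (by positivity)
  linarith

end Summit.NavierStokesRegularity.NavierStokesRegularity.Theorems.AveragedConeLiouville.PositivityDensity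

end
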